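import Summits.BirchSwinnertonDyer.BirchSwinnertonDyer.Theorems.SignedLowerHalvesSmallImageLowerHalfBothSignsRttD2SeqJ3Assembly
import HarnessLib

/-!
# Route `SignedLowerHalves`, crux L `SmallImageLowerHalfBothSigns` (stmt-BirchSwinnertonDyer-23599), line `rtt_w3` v14 → v15 — E2, row J3 (Galois side):
# THE TWO REMAINING POITOU–TATE INPUTS OF J3 IN PURELY FINITE-LEVEL FORM (no Iwasawa datum, no limit): `levelwise reciprocity ⟹ hrecL`, and J3 from the levelwise statements

WIDTH seat `bsd-line-slh-p3-w3` g22 under LEAD `cruxlead-stmt-BirchSwinnertonDyer-23599` g11 (cell `bsd-ssimc`); helper `--supports stmt-BirchSwinnertonDyer-23599`. THEOREMS ONLY.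
HONEST FRAMING: a reduction (bookkeeping): the hypothesis `hrecL` of the one-call assembly `exists_junction_exact_of_inputs` (p790304) quantifies over elements `b` of honda's
Iwasawa datum; it follows from the statement `LevelwiseReciprocity` below, which mentions ONLY level-`(n,k)` objects — a strict class `y ∈ Str_{n,k}`, a torsion-level local class `ℓ`
lifting the localisation of a Selmer class `c ∈ Sel^{ε,S₀}_𝒪(K_n, M)`, and the value `⟨y, ℓ⟩_{n,k} = inv_{U_{n,v}}(loc_{n,v} y ∪ ℓ)/p^k` — i.e. the Poitou–Tate SUM FORMULA at `K_n`
(all terms away from `v` vanish: above `S₀` because `y` is strict, elsewhere by the local conditions of `c`). Proving `LevelwiseReciprocity` and the solvability `hsolL` is the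
remaining mathematics (junction-1 / successor). E2, crux L, crux M and BSD remain OPEN and are proved for NO curve.

* `pairLayer_layerPairingOf_eq` (the layer pairing of the inhabitant on a lifted class IS `locPairNK`), ★ `hrecL_of_levelwise`, ★★★ `exists_junction_exact_of_levelwise`.
References: [NeukirchSchmidtWingberg2008] VIII §6 (8.6.*), (7.2.6); [Rubin2000] Thm. 1.7.3; [Kobayashi2003] Thm. 7.3 i); [Kato2004Asterisque] §17.13.
-/

set_option autoImplicit false
set_option linter.dupNamespace false -- D-0017: single-problem summit, the namespace repeats the problem name by design
noncomputable section

open scoped Classical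
open NumberField IsDedekindDomain Field

namespace Summit.BirchSwinnertonDyer.BirchSwinnertonDyer.Theorems.SmallImageRttD2Seq

open Literature.NumberTheory.EllipticCurves Literature.NumberTheory.EllipticCurves.Kobayashi2003
  Literature.NumberTheory.EllipticCurves.GreenbergVatsal2000 Literature.NumberTheory.GaloisRepresentations Literature.NumberTheory.GaloisCohomology
  Literature.NumberTheory.ComplexMultiplication.EllipticUnits.JohnsonLeungKings2011
  Summit.BirchSwinnertonDyer.BirchSwinnertonDyer.Theorems.SmallImageCharSignedSelmer
  Summit.BirchSwinnertonDyer.BirchSwinnertonDyer.Theorems.SmallImageRttD2J1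

section Levelwise

variable {K : Type} [Field K] [NumberField K] {p : ℕ} [Fact p.Prime] {κ : ZpExtension K p} {γ : absoluteGaloisGroup K}
  (S : Set (PadicAlgCl p)) [FiniteDimensional ℚ_[p] (padicCoeffField S)]
  {M : Type} [AddCommGroup M] [DistribMulAction (absoluteGaloisGroup K) M] [TopologicalSpace M] [DiscreteTopology M]
  [Module (padicCoeffIntegers S) M] [SMulCommClass (absoluteGaloisGroup K) (padicCoeffIntegers S) M]
  {V : WeierstrassCurve K} {j : V.geomPrimaryTorsion p →+ M} {S₀ : Set (HeightOneSpectrum (𝓞 K))} {ε : ℤˣ}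
  (D : SignedTransportDualDataSat κ γ M (padicCoeffIntegers S) V j S₀ ε)
  {v : HeightOneSpectrum (𝓞 K)} [DistribMulAction (absoluteGaloisGroup (v.adicCompletion K)) M]
  [SMulCommClass (absoluteGaloisGroup (v.adicCompletion K)) (padicCoeffIntegers S) M]
  {γv : absoluteGaloisGroup (v.adicCompletion K)} (DQ : LocalCondDualData κ M (padicCoeffIntegers S) V j ε v γv)
  (hres : ∀ (σ : absoluteGaloisGroup (v.adicCompletion K)) (m : M), σ • m = resGalOfEmb (closureEmb (K := K) (v.adicCompletion K)) σ • m)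
  (hvp : (p : 𝓞 K) ∈ v.asIdeal)
  {γB : absoluteGaloisGroup K} {θ' : absoluteGaloisGroup K →ₜ* (padicCoeffIntegers S)ˣ} {P : Set (HeightOneSpectrum (𝓞 K))}
  (I : CycIwasawaCohomologyDataO S κ γB θ' P 1)
  (hstab : ∀ m : M, IsOpen (MulAction.stabilizer (absoluteGaloisGroup (v.adicCompletion K)) m : Set (absoluteGaloisGroup (v.adicCompletion K))))
  (Pk : ∀ k : ℕ, ContPairing (locCoeffRep S θ' P v k).toTopRep (torsRep M hstab p k).toTopRep (muAt K (p ^ k) v).toTopRep)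
  (htor : ∀ m : M, ∃ k : ℕ, p ^ k • m = 0)
  (hγB : γB * resGalOfEmb (closureEmb (K := K) (v.adicCompletion K)) γv ∈ κ.kerSubgroup)
  (hNP : ∀ n, ramificationSubgroup K P ≤ κ.layerSubgroup n) (hv : AcSigned.IsNonsplitIn κ v)
  (hPred : ∀ (k : ℕ) (x : ↥(Representation.invariants ((muTwistO S θ' (k + 1)).toRepresentation.comp (ramificationSubgroup K P).subtype))) (m : ↥(torsionPow M p k)),
    (Pk (k + 1)).toLin x (AddSubgroup.inclusion (torsionPow_mono (M := M) (p := p) (Nat.le_succ k)) m) =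
      muInclusion K (pow_dvd_pow p (Nat.le_succ k)) ((Pk k).toLin (coeffMapO S P θ' (oMuRed S k) (oMuRed_muTwistO S θ' k) x) m))
  (hPsc : ∀ (k : ℕ) (a : padicCoeffIntegers S) (x : ↥(Representation.invariants ((muTwistO S θ' k).toRepresentation.comp (ramificationSubgroup K P).subtype)))
    (m : ↥(torsionPow M p k)), (Pk k).toLin (coeffMapO S P θ' (oMuScalar S (p ^ k) a) (oMuScalar_muTwistO S θ' k a) x) m = (Pk k).toLin x (a • m))

omit [FiniteDimensional ℚ_[p] (padicCoeffField S)] [DistribMulAction (absoluteGaloisGroup K) M] [SMulCommClass (absoluteGaloisGroup K) (padicCoeffIntegers S) M] in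
/-- The layer pairing of the inhabitant on a class lifted to `M[p^k]` IS the torsion-level pairing `locPairNK`. [cite: PerrinRiou1994Invent, §3.6.1] -/
theorem pairLayer_layerPairingOf_eq (n k : ℕ) (b : I.H)
    (ℓ : subgroupH1 (localSubgroupOfEmb (κ.layerSubgroup n) (closureEmb (K := K) (v.adicCompletion K))) ↥(torsionPow M p k)) :
    (layerPairingOf S κ θ' P v M hstab Pk htor γB γv hγB hNP hv hPred hPsc).pairLayer n b (torsToH1 M p _ k ℓ) = locPairNK S κ θ' P v M hstab Pk n k (I.proj n k b) ℓ :=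
  (layerPairingOf S κ θ' P v M hstab Pk htor γB γv hγB hNP hv hPred hPsc).pairLayer_apply_toH1 n b ℓ

omit [FiniteDimensional ℚ_[p] (padicCoeffField S)] [SMulCommClass (absoluteGaloisGroup K) (padicCoeffIntegers S) M] in
/-- ★ **`hrecL` FROM THE LEVELWISE RECIPROCITY**: if every strict class `y ∈ Str_{n,k}` pairs to zero with every torsion-level local class `ℓ` lifting `loc_{v,n} c`, `c` a Selmer class of
`K_n`, then the layer pairings of every strict norm-compatible family kill `loc_{v,n}(Sel^{ε,S₀}_𝒪(K_n, M))` (exhaustion `exists_torsToH1_eq`).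
[cite: NeukirchSchmidtWingberg2008, VIII §6 (8.6.*)] [cite: Rubin2000, Thm. 1.7.3] -/
theorem hrecL_of_levelwise
    (R : ∀ (n k : ℕ) (y : cycLayerCohO S κ θ' P n k 1), y ∈ strictLevel S κ θ' P S₀ n k →
      ∀ (ℓ : subgroupH1 (localSubgroupOfEmb (κ.layerSubgroup n) (closureEmb (K := K) (v.adicCompletion K))) ↥(torsionPow M p k))
        (c : subgroupH1 (κ.layerSubgroup n) M), c ∈ signedTransportSelmerLayerSat κ M (padicCoeffIntegers S) V j S₀ ε n →
        torsToH1 M p _ k ℓ = locH1Layer κ M v hres n c → locPairNK S κ θ' P v M hstab Pk n k y ℓ = 0)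
    (n : ℕ) (b : I.H) (hb : ∀ n k : ℕ, I.proj n k b ∈ strictLevel S κ θ' P S₀ n k) (c : subgroupH1 (κ.layerSubgroup n) M)
    (hc : c ∈ signedTransportSelmerLayerSat κ M (padicCoeffIntegers S) V j S₀ ε n) :
    (layerPairingOf S κ θ' P v M hstab Pk htor γB γv hγB hNP hv hPred hPsc).pairLayer n b (locH1Layer κ M v hres n c) = 0 := by
  haveI : CompactSpace (absoluteGaloisGroup (v.adicCompletion K)) := absoluteGaloisGroup_compactSpace _
  haveI : CompactSpace ↥(localSubgroupOfEmb (κ.layerSubgroup n) (closureEmb (K := K) (v.adicCompletion K))) :=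
    isCompact_iff_compactSpace.mp (isClosed_localLayer κ v n).isCompact
  obtain ⟨k, ℓ, hℓ⟩ := exists_torsToH1_eq _ htor (locH1Layer κ M v hres n c)
  rw [← hℓ, pairLayer_layerPairingOf_eq]
  exact R n k _ (hb n k) ℓ c hc hℓ

/-- ★★★ **J3 FROM THE TWO LEVELWISE POITOU–TATE STATEMENTS** (and the coefficient pairings): `exists_junction_exact_of_inputs` (p790304) with `hrecL` replaced by the purely finite-level
reciprocity `R`. [cite: Kobayashi2003, Thm. 7.3 i)] [cite: Rubin2000, Thm. 1.7.3] [cite: NeukirchSchmidtWingberg2008, VIII §6] [cite: Kato2004Asterisque, §17.13] -/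
theorem exists_junction_exact_of_levelwise (instX : Module (IwasawaAlgebraO S) D.X) (instQ : Module (IwasawaAlgebraO S) DQ.X)
    (hιX : ∀ (f : IwasawaAlgebra p) (x : D.X), (letI := instX; iwasawaToIwasawaO S f • x) = f • x)
    (hιQ : ∀ (f : IwasawaAlgebra p) (x : DQ.X), (letI := instQ; iwasawaToIwasawaO S f • x) = f • x)
    (hCX : ∀ (a : padicCoeffIntegers S) (x : D.X) (s : signedTransportSelmerInftySat κ M (padicCoeffIntegers S) V j S₀ ε),
      D.toDual (letI := instX; (PowerSeries.C a : IwasawaAlgebraO S) • x) s =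
        D.toDual x ⟨GreenbergSelmer.scalarH1 κ.kerSubgroup M a s, scalarH1_mem_signedTransportSelmerInftySat κ M (padicCoeffIntegers S) V j S₀ ε a s.2⟩)
    (hCQ : ∀ (a : padicCoeffIntegers S) (x : DQ.X) (c : localCondInftySat κ M (padicCoeffIntegers S) V j ε v),
      DQ.toDual (letI := instQ; (PowerSeries.C a : IwasawaAlgebraO S) • x) c = DQ.toDual x (scalarLocalSat κ M (padicCoeffIntegers S) V j ε v a c))
    (hstabK : ∀ m : M, IsOpen (MulAction.stabilizer (absoluteGaloisGroup K) m : Set (absoluteGaloisGroup K)))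
    (hγ : κ.IsTopGenerator γ) (hγv : κ.IsTopGenerator (resGalOfEmb (closureEmb (K := K) (v.adicCompletion K)) γv)) (hP : P.Finite)
    (R : ∀ (n k : ℕ) (y : cycLayerCohO S κ θ' P n k 1), y ∈ strictLevel S κ θ' P S₀ n k →
      ∀ (ℓ : subgroupH1 (localSubgroupOfEmb (κ.layerSubgroup n) (closureEmb (K := K) (v.adicCompletion K))) ↥(torsionPow M p k))
        (c : subgroupH1 (κ.layerSubgroup n) M), c ∈ signedTransportSelmerLayerSat κ M (padicCoeffIntegers S) V j S₀ ε n →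
        torsToH1 M p _ k ℓ = locH1Layer κ M v hres n c → locPairNK S κ θ' P v M hstab Pk n k y ℓ = 0)
    (hsolL : ∀ q : localCondInftySat κ M (padicCoeffIntegers S) V j ε v →+ AddCircle (1 : ℚ),
      (∀ s : signedTransportSelmerInftySat κ M (padicCoeffIntegers S) V j S₀ ε, q (locSat κ M (padicCoeffIntegers S) V j S₀ ε v hres hvp s) = 0) →
      ∀ m : ℕ, ∃ y ∈ strictLevel S κ θ' P S₀ m m,
        ∀ (ℓ : subgroupH1 (localSubgroupOfEmb (κ.layerSubgroup m) (closureEmb (K := K) (v.adicCompletion K))) ↥(torsionPow M p m))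
          (hℓ : ℓ ∈ goodLevel S κ v M V j ε m m), locPairNK S κ θ' P v M hstab Pk m m y ℓ = q ⟨_, hℓ⟩) :
    letI := instX; letI := instQ
    ∃ j₀ : strictCarrier I (strictLevel S κ θ' P S₀) (fun n k f _ hy ↦ smul_mem_strictLevel S κ θ' P S₀ γB n k f hy) →ₗ[IwasawaAlgebraO S] DQ.X,
      (∀ b, DQ.toDual (j₀ b) = strictPairing (layerPairingOf S κ θ' P v M hstab Pk htor γB γv hγB hNP hv hPred hPsc) I (strictLevel S κ θ' P S₀)
        (fun n k f _ hy ↦ smul_mem_strictLevel S κ θ' P S₀ γB n k f hy) hstab b) ∧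
      Function.Exact j₀ (gXLinearMapO S D DQ hres hvp instX instQ hιX hιQ hCX hCQ htor hstabK hstab hγ hv hγv) :=
  exists_junction_exact_of_inputs S D DQ hres hvp I hstab Pk instX instQ hιX hιQ hCX hCQ htor hstabK hγ hv hγv hγB hNP hP hPred hPsc
    (hrecL_of_levelwise S hres I hstab Pk htor hγB hNP hv hPred hPsc R) hsolL

end Levelwise

end Summit.BirchSwinnertonDyer.BirchSwinnertonDyer.Theorems.SmallImageRttD2Seq

end
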